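import Mathlib
import Literature.Probability.Percolation.SmoothedWhiteNoise
import Literature.Probability.Percolation.PositiveAssociation
import Literature.Probability.Percolation.KSTPeriodicDefs
import Literature.Probability.Percolation.KSTPeriodicStatements
import Literature.Probability.Percolation.KSTPeriodicArmDuality
import Literature.Probability.Percolation.KSTPeriodicBridges
import Literature.Probability.Percolation.KSTPeriodicArms
import Literature.Probability.Percolation.KSTPeriodicTopology
import Literature.Probability.Percolation.KSTPeriodicTopologyII
import Literature.Probability.Percolation.KSTPeriodicCorridor
import Literature.Probability.Percolation.KSTPeriodicQuasi
import Literature.Probability.Percolation.KSTPeriodicClosing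
import Literature.Probability.Percolation.KSTPeriodicWeakPos
import Literature.Probability.Percolation.KSTPeriodicCascadeStep
import Summits.CriticalPhenomena.CardyFormulaZ2.Theorems.CardyWhiteToColouredDriftBoundStubSignLawInvariant
import Summits.CriticalPhenomena.CardyFormulaZ2.Theorems.CardyWhiteToColouredDriftBoundStubSignLawPosAssoc
import Summits.CriticalPhenomena.CardyFormulaZ2.Theorems.CardyWhiteToColouredDriftBoundStubSignLawSelfDual
import Summits.CriticalPhenomena.CardyFormulaZ2.Theorems.CardyWhiteToColouredDriftBoundStubShortWayHalf
import Summits.CriticalPhenomena.CardyFormulaZ2.Theorems.CardyWhiteToColouredDriftBoundStubOpenHalf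

/-!
# Uniform Russo–Seymour–Welsh bounds for the sign of Gaussian-smoothed white noise on `ℤ²`

Helper file for the crux item `stmt-CriticalPhenomena-4596`
(`Summit.CriticalPhenomena.CardyFormulaZ2.Theses.CardyWhiteToColoured.DriftBound`, route
`CardyWhiteToColoured` of `CardyFormulaZ2`), line `registered` (`Cruxes/DriftBound/Lines/birth.lean`,
skeleton v3, lead c2): the glue of the five RSW stubs of the line.

The crux runs along the one-parameter family of lattice models `sign(k_σ ⋆ ξ)`, `σ ∈ (0, ∞)` — the
sign configuration `signConfig σ 1 ξ = {e ∈ E(ℤ²) | ∑_{e'} exp(−|m e − m e'|²/(2σ²)) ξ_{e'} > 0}` of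
i.i.d. `N(0,1)` edge-midpoint noise `ξ` smoothed by the Gaussian kernel of width `σ` lattice
spacings, with law `signConfigLaw σ 1` on bond configurations of `ℤ²` (`σ → 0`: critical bond
percolation; `σ → ∞` at fixed physical scale: the smooth Bargmann–Fock-type field). The route's
named risk for this crux was that "no RSW is in print for the sign fields at the crossover
`√t ≍ δ`". This file proves RSW for the whole family, with constants UNIFORM in `σ`:

* `admissible_signConfigLaw` — for `σ > 0`, `signConfigLaw σ 1` is `kℤ² ⋊ D₄`-admissible with
  `k = 1`, `t = 0` in the sense of the tree's periodic Köhler-Schindler–Tassion theory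
  (`KSTPeriodic.Admissible 1 0`): invariant under all translations, the transposition and the
  reflection `x ↦ (−x₀, x₁)` (stub `stub_signLawInvariant`), and positively associated (stub
  `stub_signLawPosAssoc`, Harris for the Gaussian product measure);
* `shortWay_signConfigLaw` — the short-way crossing `𝓒₀(N, 8N)` has probability `≥ 1/2` for every
  `N ≥ 1` and every `σ > 0` (stub `stub_shortWayHalf`, from planar duality and the exact
  self-duality `stub_signLawSelfDual`: the dual edge has the same midpoint and `ξ ↦ −ξ` preserves the
  noise);
* `rowFiniteEnergy_signConfigLaw` — `L` consecutive edges of a row are all open with probability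
  `≥ (1/2)^L` (positive association and `stub_openHalf`: every edge is open with probability `1/2`);
* `uniformRSW_signConfigLaw` — **uniform RSW**: for every integer aspect ratio `ρ ≥ 1` there are
  `c > 0` and `N₁` such that for EVERY `σ > 0` and every `N ≥ N₁`,
  `(signConfigLaw σ 1)(𝓒₀(ρN, N)) ≥ c` — the long way across `[−ρN, ρN] × [−N, N]`. This is the
  tree's weak periodic Köhler-Schindler–Tassion theorem `KSTPeriodic.WeakPeriodicRSW 1 0`
  (Literature `KSTPeriodic*`, every planar and probabilistic step proved there) applied with the
  `σ`-free inputs `ε = p₀ = 1/2`;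
* `uniformRSW_dual_signConfigLaw` — the same bound for the planar dual law, which by exact
  self-duality IS `signConfigLaw σ 1`; so long-way crossings by CLOSED dual edges are equally likely
  and the family is uniformly "critical-like" at every scale `N ≥ N₁` and every width `σ`.

References: L. Köhler-Schindler, V. Tassion, Duke Math. J. 172 (2023) Thm 1 + Comment 1
[KohlerSchindlerTassion2023]; V. Beffara, D. Gayet, Publ. IHÉS 126 (2017) (RSW for Bargmann–Fock)
[BeffaraGayet2017]; S. Muirhead, H. Vanneuville, AIHP 56 (2020) §2.1 [MuirheadVanneuville2020];
G. Grimmett, Percolation (1999) §11.7 [GrimmettPercolation1999].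
-/

noncomputable section

namespace Summit.CriticalPhenomena.CardyFormulaZ2.Cruxes.DriftBound.Birth

open Set Filter MeasureTheory
open Literature.Probability.LatticeModels Literature.Probability.Percolation

/-- The weak `kℤ² ⋊ D₄`-periodic Köhler-Schindler–Tassion theorem at period `k = 1`, offset
`t = 0` (the paper's own setting), assembled from the Literature steps: arms (Lemma 1(ii)),
quasi-crossings (Lemma 3), closing (Lemma 5), cascading at positive scales (Lemma 4 via the
corridor lemma) and bridges (Lemma 1(i),(iii)). [cite: KohlerSchindlerTassion2023, Theorem 1] -/
theorem weakPeriodicRSW_one_zero : KSTPeriodic.WeakPeriodicRSW 1 0 := by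
  have hD : KSTPeriodic.ArmDuality := KSTPeriodic.armDuality
  exact KSTPeriodic.weakPeriodicRSW_of_pos le_rfl
    (KSTPeriodic.armsOfShortCrossings_of le_rfl KSTPeriodic.archesMeet KSTPeriodic.partsToSegmentsMeet hD)
    (KSTPeriodic.quasiOfArms_of KSTPeriodic.topSideToLeftMeetsTB KSTPeriodic.topSideToRightMeetsTB
      KSTPeriodic.alternatingTBMeet (KSTPeriodic.corridorA_of_armDuality hD))
    (KSTPeriodic.closingIneq_of KSTPeriodic.partsMeetMPath 1 0)
    (KSTPeriodic.cascadeStepPos_of_corridorB le_rfl (Nat.zero_le 1) (KSTPeriodic.corridorB_of_armDuality hD))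
    (KSTPeriodic.bridgesGiveCrossings_of KSTPeriodic.archesMeet KSTPeriodic.partsToSegmentsMeet)

/-- **Admissibility.** For `σ > 0` the sign law `signConfigLaw σ 1` satisfies the standing
hypotheses `KSTPeriodic.Admissible 1 0` of the periodic Köhler-Schindler–Tassion theorem:
invariance under every translation of `ℤ²`, the transposition and the reflection in `x₀ = 0`,
and positive association. -/
theorem admissible_signConfigLaw {σ : ℝ} (hσ : 0 < σ) : KSTPeriodic.Admissible 1 0 (signConfigLaw σ 1) := by
  obtain ⟨hsh, htr, hfl⟩ := stub_signLawInvariant σ hσ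
  exact
    { shift_inv := fun v => by simpa using hsh ((1 : ℤ) • v)
      transpose_inv := htr
      flip_inv := hfl
      posAssoc := stub_signLawPosAssoc σ hσ }

/-- **Short-way crossings.** For `σ > 0` and `N ≥ 1` the horizontal crossing `𝓒₀(N, 8N)` of
`[−N, N] × [−8N, 8N]` has `signConfigLaw σ 1`-probability at least `1/2` (planar duality + exact
self-duality + lattice symmetries). -/
theorem shortWay_signConfigLaw {σ : ℝ} (hσ : 0 < σ) {N : ℕ} (hN : 1 ≤ N) :
    (1 / 2 : ℝ) ≤ (signConfigLaw σ 1).real (KSTPeriodic.crossing 0 N (8 * N)) :=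
  stub_shortWayHalf stub_signLawInvariant stub_signLawSelfDual σ hσ N hN

/-- **Row finite energy with `p₀ = 1/2`.** For `σ > 0`, `L` consecutive horizontal edges of the
row `x₁ = 0` are all open with `signConfigLaw σ 1`-probability `≥ (1/2)^L` (positive association
of the increasing coordinate events, each of probability exactly `1/2`). -/
theorem rowFiniteEnergy_signConfigLaw {σ : ℝ} (hσ : 0 < σ) (a : ℤ) (L : ℕ) :
    (1 / 2 : ℝ) ^ L ≤ (signConfigLaw σ 1).real
      {ω | ∀ i : ℕ, i < L → s(![a + i, 0], ![a + i + 1, 0]) ∈ ω} := by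
  classical
  haveI := sw_isProbabilityMeasure_signConfigLaw σ 1
  set A : Fin L → Set (BondConfig (Site 2)) := fun i => {ω | s(![a + i, 0], ![a + i + 1, 0]) ∈ ω}
    with hA
  have hset : {ω : BondConfig (Site 2) | ∀ i : ℕ, i < L → s(![a + i, 0], ![a + i + 1, 0]) ∈ ω} =
      ⋂ i : Fin L, A i := by
    ext ω
    simp only [Set.mem_setOf_eq, Set.mem_iInter, hA]
    exact ⟨fun h i => h i i.2, fun h i hi => h ⟨i, hi⟩⟩
  have hedge : ∀ i : Fin L, s(![a + i, 0], ![a + i + 1, 0]) ∈ (zdGraph 2).edgeSet := by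
    intro i
    rw [SimpleGraph.mem_edgeSet, zdGraph_two_adj_iff]
    left
    refine ⟨?_, ?_⟩ <;> simp
  have hup : ∀ i, IsUpperSet (A i) := fun i ω ω' hle hω => hle hω
  have hmeas : ∀ i, MeasurableSet (A i) := fun i => measurableSet_mem _
  have hprod := (stub_signLawPosAssoc σ hσ).prod_real_le_iInter hup hmeas
  rw [hset]
  refine le_trans (le_of_eq ?_) hprod
  rw [Finset.prod_congr rfl fun i _ => stub_openHalf σ hσ _ (hedge i)]
  simp

/-- **Uniform RSW for the sign of Gaussian-smoothed lattice white noise.** For every integer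
aspect ratio `ρ ≥ 1` there are `c > 0` and `N₁` such that for EVERY smoothing width `σ > 0` and
every scale `N ≥ N₁`, the long-way open crossing `𝓒₀(ρN, N)` of `[−ρN, ρN] × [−N, N]` has
`signConfigLaw σ 1`-probability at least `c`. (Weak periodic Köhler-Schindler–Tassion theorem at
`k = 1`, `t = 0`, fed with the `σ`-free inputs: short-way bound `ε = 1/2`, row finite energy
`p₀ = 1/2`.) -/
theorem uniformRSW_signConfigLaw :
    ∀ ρ : ℕ, 1 ≤ ρ → ∃ c : ℝ, 0 < c ∧ ∃ N₁ : ℕ, ∀ σ : ℝ, 0 < σ → ∀ N : ℕ, N₁ ≤ N →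
      c ≤ (Literature.Probability.Percolation.signConfigLaw σ 1).real
        (Literature.Probability.Percolation.KSTPeriodic.crossing 0 (ρ * N) N) := by
  intro ρ hρ
  obtain ⟨c, hc, N₁, H⟩ := weakPeriodicRSW_one_zero (1 / 2) (1 / 2) (by norm_num) (by norm_num) 1 ρ hρ
  refine ⟨c, hc, N₁, fun σ hσ N hN => ?_⟩
  haveI := sw_isProbabilityMeasure_signConfigLaw σ 1
  exact H (signConfigLaw σ 1) (admissible_signConfigLaw hσ) (sw_latticeCarried_signConfigLaw σ 1)
    (fun M hM _ => shortWay_signConfigLaw hσ hM)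
    ⟨0, fun a L => rowFiniteEnergy_signConfigLaw hσ a L⟩ N hN

/-- **Uniform RSW for the dual (closed) crossings.** The planar dual law of `signConfigLaw σ 1`
is `signConfigLaw σ 1` itself (`stub_signLawSelfDual`), so the uniform long-way bound holds
verbatim for the law of the dual configuration: crossings of `[−ρN, ρN] × [−N, N]` in the dual
lattice by dual edges crossing CLOSED primal edges are at least as likely as `c(ρ) > 0`, uniformly
in `σ > 0` and `N ≥ N₁(ρ)`. -/
theorem uniformRSW_dual_signConfigLaw :
    ∀ ρ : ℕ, 1 ≤ ρ → ∃ c : ℝ, 0 < c ∧ ∃ N₁ : ℕ, ∀ σ : ℝ, 0 < σ → ∀ N : ℕ, N₁ ≤ N →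
      c ≤ ((signConfigLaw σ 1).map dualConfig).real (KSTPeriodic.crossing 0 (ρ * N) N) := by
  intro ρ hρ
  obtain ⟨c, hc, N₁, H⟩ := uniformRSW_signConfigLaw ρ hρ
  refine ⟨c, hc, N₁, fun σ hσ N hN => ?_⟩
  rw [stub_signLawSelfDual σ hσ]
  exact H σ hσ N hN

end Summit.CriticalPhenomena.CardyFormulaZ2.Cruxes.DriftBound.Birth

end
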